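import Literature.NumberTheory.EllipticCurves.RankinSymmSquareGL2Bound
import Literature.NumberTheory.EllipticCurves.RankinSymmSquareTwistComparison
import Literature.NumberTheory.EllipticCurves.NewformPeterssonSizeRankinSelbergProofs
import Literature.NumberTheory.EllipticCurves.NewformPeterssonSizeProofs
import Literature.NumberTheory.LFunctions.EstermannLemmaDisc
import Literature.NumberTheory.LFunctions.SiegelTheoremAbstract
import Literature.NumberTheory.LFunctions.ZetaRealAxis
import HarnessLib

/-!
# Murty's bound `(f, f) ≫ N^{1−ε}` from a zero-free interval of `L_f(s) = ζ(2s)L(|a|², s+1)/ζ(s)`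
# (the continued imprimitive symmetric square) — every level `N`, case A of Siegel/GHL

Topic `NumberTheory/EllipticCurves`; namespace `Literature.NumberTheory.EllipticCurves.ModularForms`.
Proof file (theorems only; no definition, no named fact — D-0026) of the `provefact` unit of the
named fact `murty_petersson_newform_lower_bound` (`NewformPeterssonSize.lean`).

**The carrier.** For `f ∈ S₂(Γ₀(N))`, ANY level `N ≥ 1`, `RankinSymmSquareGL2Fields` defines
`L_f(s) := symmSqL N f s = Λ_f(s)/((s − 1)ζ(s)A(s))`, where `Λ_f = rankinLambda N f` is the Rankin–Selberg
function of `f` against the level-`N` Eisenstein series AT THE CUSP `∞` (Möbius-isolated, continued to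
`Re s > 0` in `Gamma0RankinSelbergContinuation`) and `A(s) = π^{-s}Γ(s)Γ(s+1)(4π)^{-(s+1)}`. On
`Re s > 1`, `L_f(s) = ζ(2s) Σₙ |aₙ(f)|² n^{-(s+1)}/ζ(s)` (`symmSqL_eq_of_one_lt_re`): for a normalised
Hecke eigenform this Dirichlet series is EULERIAN and equals the symmetric-square `L`-function
`L(s, Sym² f)` up to finitely many local factors at `p ∣ N`, each positive and finite at every real
`σ > 0`; so the real zeros of `L_f` in `(1 − 2r, 1)` (`r` the uniform radius of `exists_siegel_radius`,
where `L_f` is holomorphic: `differentiableOn_symmSqL_ball`) are exactly the real zeros there of the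
continued `L(s, Sym² f)` — the object of the theorem of Goldfeld–Hoffstein–Lieman (appendix to
[HoffsteinLockhart1994]): "`L(s, Sym² f)` has no real zero in `1 − c/log(N + 1) ≤ σ < 1`" for `f` not of
CM type. (The sibling carrier `symmSqRS` of `NewformSymmSquareRSContinuation` is the `SL₂(ℤ)`-TRACE
zeta function, Eulerian for squarefree `N` only; the present file covers every `N`, i.e. every
elliptic curve over `ℚ`, not only the semistable ones.)

**What is proved** (all inputs are PROVED theorems of the tree: `symmSqL_coeff₁` — non-negative
Dirichlet coefficients with `a(1) = 1` for `(s−1)ζ(s)L_f(s)`; `symmSqL_ofReal_im_eq_zero` — reality;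
`symmSqL_one` — `L_f(1) = 8π³ Re(f,f)/[SL₂(ℤ):Γ₀(N)] > 0`; `exists_norm_symmSqL_le` — the weak polynomial
bound `‖L_f(s)‖ ≤ B N¹⁵ max(1, Re L_f(1))` on the Siegel disc; `EstermannDisc.exists_estermann_constants` —
Montgomery–Vaughan Lemma 11.13 on a disc of radius `1 + r`):

* `exists_symmSqL_estermann_ineq` — Estermann's inequality for `H = ζ₁ · L_f`
  (`ζ₁(s) = (s − 1)ζ(s)`): for every `f` with `a₁(f) = 1`, every `0 < δ ≤ r/2` such that `L_f(σ) ≠ 0`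
  on `[1 − δ, 1)`: `c_E δ (M₀ N¹⁵ max(1, Re L_f(1)))^{−A_E δ} ≤ Re L_f(1)`;
* `petersson_lower_bound_log_of_symmSqL_zeroFree` — **the effective case A**: there is an absolute
  `A₀ > 0` such that for every `A ≥ A₀` there is `c(A) > 0` with `c N/log(N+2) ≤ Re (f,f)_{Γ₀(N)}`
  for every `N` and every `f ∈ S₂(Γ₀(N))` with `a₁(f) = 1` whose `L_f` has no zero on
  `[1 − 1/(A log(N+2)), 1)` ([HoffsteinLockhart1994], p. 161: "it is easy to show
  `1/log N ≪ L(1, Sym² f)` provided there is no Siegel zero"; here with `δ = 1/(A log(N+2))`,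
  `N^{−15A_Eδ} ≥ e^{−O(1)}`);
* `murty_petersson_newform_lower_bound_of_symmSqL_noExceptionalZero` — **the named fact holds if the
  `L_f` of the newforms of elliptic curves over `ℚ` have no exceptional real zero**: one constant
  `A > 0` with `L_f(σ) ≠ 0` for `1 − 1/(A log(N+2)) ≤ σ < 1`, all `N`, `E/ℚ`, `f` (`IsNewformOf E f`) —
  Goldfeld–Hoffstein–Lieman's theorem for non-CM `f`, plus the CM case (Hecke `L`-functions of
  `ℚ(i)`, `ℚ(√−3)` and the seven other CM fields), NEITHER formalised — implies
  `murty_petersson_newform_lower_bound` (`log(N+2) ≤ (3N)^ε/ε`); and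
  `murty_petersson_newform_lower_bound_of_symmSqL_zeroFree` — the same from one uniform `δ₀ > 0`;
* `symmSqL_ofReal_eq_zero_iff_rankinLambda` — for real `0 < σ < 1` in the ball, `L_f(σ) = 0 ↔ Λ_f(σ) = 0`
  (`ζ(σ) < 0` on `(0,1)`, `ZetaRealAxis`); and `symmSqL_ofReal_eq_zero_iff_of_twistEquiv` /
  `twistEquiv_zeroFree_iff` — **real zeros of `L_f` near `1` are invariants of the twist class**
  (`|a_p(f₁)| = |a_p(f₂)|` for `p ∤ N₁N₂`): by the identity `L_{f₁} ∏_{p∣N₁N₂} E_p(f₂, ·) =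
  L_{f₂} ∏_{p∣N₁N₂} E_p(f₁, ·)` on the Siegel ball (`symmSqL_mul_prod_sqLocalFactor_eq`) and
  `E_p(f, σ) ≥ 1` for real `σ > 0`, so the zero-free hypothesis needs checking on one newform per
  quadratic-twist class only.

What this file does NOT do: the exceptional case (a real zero of some `L_{f₁}` close to `1`), which is
Siegel's ineffective argument with the `GL(3) × GL(3)` pair function `L(s, Sym² f₁ × Sym² f)`
([HoffsteinLockhart1994] Thm. 0.1; reduced to pair data in `NewformPeterssonSizePairReductionProofs`),
or the proof that no such zero exists (Goldfeld–Hoffstein–Lieman: `ζ L(Sym² f)² L(Sym² f × Sym² f)`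
has a double pole and a triple zero; needs the Gelbart–Jacquet lift — the unproved named fact
`Literature.NumberTheory.Automorphic.GelbartJacquet_symmSq_cuspidal` — and `GL(3)` Rankin–Selberg
theory). With `GL(2) × GL(2)` convolutions alone every auxiliary Dirichlet series with non-negative
coefficients contains `L(Sym² f)` with multiplicity at most its pole order, so neither device applies.

## References

* [HoffsteinLockhart1994] J. Hoffstein, P. Lockhart, *Coefficients of Maass forms and the Siegel zero*,
  Ann. of Math. 140 (1994) 161–181, p. 161, Thm. 0.1, and the Appendix by D. Goldfeld, J. Hoffstein,
  D. Lieman (pp. 177–181).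
* [MurtyCongruencePrimes1999] M. R. Murty, *Bounds for congruence primes*, Proc. Sympos. Pure Math.
  66.1 (1999), §2 ("By a result of Hoffstein and Lockhart, `log (f,f) > (1−ε) log N`").
* [MontgomeryVaughan2007] H. L. Montgomery, R. C. Vaughan, *Multiplicative Number Theory I*, CUP 2007,
  §11.2 Lemma 11.13 and the proof of Theorem 11.14 (case of no exceptional zero).
* [Rankin1939] R. A. Rankin, Proc. Cambridge Philos. Soc. 35 (1939), Thm. 3.
-/

noncomputable section

namespace Literature.NumberTheory.EllipticCurves.ModularForms

open Literature.NumberTheory.LFunctions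
open Set Filter Metric Complex CongruenceSubgroup
open scoped Real Topology

/-! ### Real points of the Siegel ball -/

/-- A real `σ` with `1 − 2r < σ ≤ 1 + r` lies in the ball `|s − 2| < 1 + 2r`. [folklore] -/
theorem ofReal_mem_siegel_ball {r σ : ℝ} (h1 : 1 - 2 * r < σ) (h2 : σ ≤ 1 + r) :
    (σ : ℂ) ∈ ball (2 : ℂ) (1 + 2 * r) := by
  rw [mem_ball, dist_eq_norm, ← Complex.ofReal_ofNat, ← Complex.ofReal_sub, Complex.norm_real,
    Real.norm_eq_abs, abs_lt]
  constructor <;> linarith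

/-! ### `ζ₁` on the real axis, and `L_f(σ) = 0 ↔ Λ_f(σ) = 0` for real `0 < σ < 1` -/

/-- `ζ₁(σ) = (σ − 1)ζ(σ)` is real for real `σ > 0` (`ζ(σ)` is real for `σ > 0`, `σ ≠ 1`, Titchmarsh
(2.1.4); `ζ₁(1) = 1`). [cite: MontgomeryVaughan2007, §11.2 (real values on the real axis)] -/
theorem riemannZeta₁_ofReal_im_eq_zero_of_pos {σ : ℝ} (h0 : 0 < σ) : (riemannZeta₁ σ).im = 0 := by
  rcases eq_or_ne σ 1 with rfl | h1
  · rw [Complex.ofReal_one, riemannZeta₁_one, Complex.one_im]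
  · have hσ1 : (σ : ℂ) ≠ 1 := by
      intro h; exact h1 (by exact_mod_cast h)
    have hsub : (σ : ℂ) - 1 ≠ 0 := sub_ne_zero.mpr hσ1
    have hζ₁ : riemannZeta₁ σ = ((σ : ℂ) - 1) * riemannZeta σ := by
      rw [riemannZeta_eq_inv_sub_mul hσ1, ← mul_assoc, mul_inv_cancel₀ hsub, one_mul]
    rw [hζ₁, show (σ : ℂ) - 1 = ((σ - 1 : ℝ) : ℂ) by push_cast; ring, Complex.im_ofReal_mul,
      riemannZeta_im_eq_zero_of_pos h0 h1, mul_zero]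


/-- For real `0 < σ < 1`: `ζ₁(σ) = (σ − 1)ζ(σ) ≠ 0` (`ζ(σ) < 0` on `(0, 1)`, Titchmarsh §2.12).
[cite: MontgomeryVaughan2007, §11.2 (ζ has no zeros on (0,1))] -/
theorem riemannZeta₁_ofReal_ne_zero_of_pos_of_lt_one {σ : ℝ} (h0 : 0 < σ) (h1 : σ < 1) :
    riemannZeta₁ σ ≠ 0 := by
  have hσ1 : (σ : ℂ) ≠ 1 := by
    intro h; have := congrArg Complex.re h; simp at this; linarith
  intro h
  have hζ := riemannZeta_eq_inv_sub_mul hσ1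
  rw [h, mul_zero] at hζ
  exact riemannZeta_ofReal_ne_zero_of_pos_of_lt_one σ h0 h1 hζ

/-- **Real zeros of `L_f` in `(0, 1)` are real zeros of `Λ_f`**: for real `0 < σ < 1`,
`L_f(σ) = 0 ↔ Λ_f(σ) = 0` (`L_f = Λ_f/(ζ₁ A)` with `ζ₁(σ) ≠ 0`, `A(σ) ≠ 0`). Here
`Λ_f = rankinLambda N f` is the continued `(s−1)π^{-s}Γ(s)ζ(2s)Γ(s+1)(4π)^{-(s+1)} Σ|aₙ|² n^{-(s+1)}`
(`rankinLambda_eq_of_one_lt_re`). [cite: Rankin1939, Thm. 3] -/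
theorem symmSqL_ofReal_eq_zero_iff_rankinLambda {N : ℕ} [NeZero N] (f : CuspForm (Gamma0 N) 2)
    {σ : ℝ} (h0 : 0 < σ) (h1 : σ < 1) :
    symmSqL N f σ = 0 ↔ rankinLambda N f σ = 0 := by
  have hA : rankinArch σ ≠ 0 := rankinArch_ne_zero (by simpa using h0)
  have hζ := riemannZeta₁_ofReal_ne_zero_of_pos_of_lt_one h0 h1
  rw [symmSqL, div_eq_zero_iff]
  constructor
  · rintro (h | h)
    · exact h
    · exact absurd h (mul_ne_zero hζ hA)
  · exact fun h ↦ Or.inl h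

/-! ### Estermann's inequality for `H = ζ₁ · L_f` -/

/-- **Estermann's inequality for `H(s) = ζ₁(s) L_f(s)`.** There are a radius `r ∈ (0, 1/4]` (with
`|s − 2| < 1 + 2r ⊆ {Re s > 0, ζ₁ ≠ 0}`) and constants `c_E, A_E > 0`, `M₀ ≥ 1` such that for every
level `N ≥ 1`, every `f ∈ S₂(Γ₀(N))` with `a₁(f) = 1` and every `0 < δ ≤ r/2` with `L_f(σ) ≠ 0` for
`1 − δ ≤ σ < 1`:
`c_E δ (M₀ N¹⁵ max(1, Re L_f(1)))^{−A_E δ} ≤ Re L_f(1)`.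
Proof: `H` is holomorphic on the ball (`differentiableOn_symmSqL_ball`), `‖H‖ ≤ 21 B N¹⁵ max(1, Re L_f(1))`
on `|s − 2| ≤ 1 + r` (`exists_norm_symmSqL_le`, `|ζ₁| ≤ 21`), `H = (s−1) Σ a(n) n^{-s}` with `a ≥ 0`,
`a(1) = 1` on `Re s > 1` (`symmSqL_coeff₁`), `H` is real on the real diameter and zero-free on
`[1 − δ, 1]` with `H(1) = L_f(1) > 0`, so `Re H(1 − δ) ≥ 0` (intermediate values), and
`EstermannDisc.estermann_lemma_disc` with `R = 1 + r`, `β = 1 − δ` applies.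
[cite: MontgomeryVaughan2007, §11.2 Lemma 11.13] [cite: HoffsteinLockhart1994, p. 161] -/
theorem exists_symmSqL_estermann_ineq :
    ∃ r : ℝ, 0 < r ∧ r ≤ 1 / 4 ∧ (∀ s ∈ ball (2 : ℂ) (1 + 2 * r), 0 < s.re ∧ riemannZeta₁ s ≠ 0) ∧
      ∃ cE AE M₀ : ℝ, 0 < cE ∧ 0 < AE ∧ 1 ≤ M₀ ∧
        ∀ (N : ℕ) [NeZero N] (f : CuspForm (Gamma0 N) 2), cuspCoeff f 1 = 1 →
          ∀ δ : ℝ, 0 < δ → δ ≤ r / 2 →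
            (∀ σ : ℝ, 1 - δ ≤ σ → σ < 1 → symmSqL N f σ ≠ 0) →
            cE * δ * (M₀ * (N : ℝ) ^ 15 * max 1 (symmSqL N f 1).re) ^ (-(AE * δ)) ≤
              (symmSqL N f 1).re := by
  obtain ⟨r, hr0, hr4, hr⟩ := exists_siegel_radius
  obtain ⟨B, hB, hBle⟩ := exists_norm_symmSqL_le hr0 hr4 hr
  have hR1 : (1 : ℝ) < 1 + r := by linarith
  have hR2 : 1 + r ≤ 3 / 2 := by linarith
  obtain ⟨cE, AE, hcE, hAE, hEst⟩ := EstermannDisc.exists_estermann_constants hR1 hR2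
  refine ⟨r, hr0, hr4, hr, cE, AE, max 1 (21 * B), hcE, hAE, le_max_left _ _, ?_⟩
  intro N _ f h1 δ hδ hδr hZ
  have hN0 : N ≠ 0 := NeZero.ne N
  have hN1 : (1 : ℝ) ≤ N := by exact_mod_cast Nat.one_le_iff_ne_zero.mpr hN0
  -- the open set and the disc
  set U : Set ℂ := ball (2 : ℂ) (1 + 2 * r) with hUdef
  have hU : IsOpen U := isOpen_ball
  have hsub : closedBall (2 : ℂ) (1 + r) ⊆ U := closedBall_subset_ball (by linarith)
  -- the function `H`
  set H : ℂ → ℂ := fun s ↦ riemannZeta₁ s * symmSqL N f s with hHdef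
  have hHd : DifferentiableOn ℂ H U :=
    differentiable_riemannZeta₁.differentiableOn.mul (differentiableOn_symmSqL_ball f hr)
  -- the bound `M`
  set L1 : ℝ := (symmSqL N f 1).re with hL1
  set M : ℝ := max 1 (21 * B) * (N : ℝ) ^ 15 * max 1 L1 with hMdef
  have hmax1 : (1 : ℝ) ≤ max 1 L1 := le_max_left _ _
  have hN15 : (1 : ℝ) ≤ (N : ℝ) ^ 15 := one_le_pow₀ hN1
  have hM1 : 1 ≤ M := by
    calc (1 : ℝ) = 1 * 1 * 1 := by ring
      _ ≤ max 1 (21 * B) * (N : ℝ) ^ 15 * max 1 L1 :=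
          mul_le_mul (mul_le_mul (le_max_left _ _) hN15 zero_le_one (zero_le_one.trans (le_max_left _ _)))
            hmax1 zero_le_one (by positivity)
  have hHM : ∀ s ∈ closedBall (2 : ℂ) (1 + r), ‖H s‖ ≤ M := by
    intro s hs
    have hs32 : s ∈ closedBall (2 : ℂ) (3 / 2) := closedBall_subset_closedBall hR2 hs
    have hζ := EstermannDisc.norm_riemannZeta₁_le_of_mem_closedBall hs32
    have hL := hBle N f s hs
    calc ‖H s‖ = ‖riemannZeta₁ s‖ * ‖symmSqL N f s‖ := norm_mul _ _
      _ ≤ 21 * (B * (N : ℝ) ^ 15 * max 1 L1) :=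
          mul_le_mul hζ hL (norm_nonneg _) (by norm_num)
      _ = 21 * B * (N : ℝ) ^ 15 * max 1 L1 := by ring
      _ ≤ M := by rw [hMdef]; gcongr; exact le_max_right _ _
  -- the Dirichlet series
  obtain ⟨a, ha0, ha1, hsum, hL⟩ := symmSqL_coeff₁ f h1
  -- positivity of `L_f(1)` and reality
  have hnorm : IsNormalized f := h1
  have hpos := symmSqL_one_re_pos f
    (lt_of_lt_of_le (by positivity) (peterssonProduct_re_ge_of_isNormalized f hnorm))
  have hH1 : H 1 = symmSqL N f 1 := by simp [hHdef, riemannZeta₁_one]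
  -- `Re H(1 - δ) ≥ 0`
  have hmemI : ∀ σ ∈ Icc (1 - δ) 1, (σ : ℂ) ∈ U := fun σ hσ ↦
    ofReal_mem_siegel_ball (by linarith [hσ.1]) (by linarith [hσ.2])
  have hcont : ContinuousOn (fun σ : ℝ ↦ H σ) (Icc (1 - δ) 1) :=
    hHd.continuousOn.comp Complex.continuous_ofReal.continuousOn fun σ hσ ↦ hmemI σ hσ
  have him : ∀ σ ∈ Icc (1 - δ) 1, (H σ).im = 0 := by
    intro σ hσ
    have h1 := riemannZeta₁_ofReal_im_eq_zero_of_pos (σ := σ) (by linarith [hσ.1])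
    have h2 := symmSqL_ofReal_im_eq_zero f hr0.le hr (hmemI σ hσ)
    simp only [hHdef, Complex.mul_im, h1, h2, mul_zero, zero_mul, add_zero]
  have hne : ∀ σ ∈ Icc (1 - δ) 1, H σ ≠ 0 := by
    intro σ hσ
    have hζ : riemannZeta₁ σ ≠ 0 := (hr _ (hmemI σ hσ)).2
    rcases eq_or_lt_of_le hσ.2 with h | h
    · subst h
      rw [Complex.ofReal_one, hH1]
      exact fun h0 ↦ hpos.1.ne' (by rw [h0, Complex.zero_re])
    · exact mul_ne_zero hζ (hZ σ hσ.1 h)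
  have hHβ : 0 ≤ (H ((1 - δ : ℝ) : ℂ)).re := by
    have h1' : 0 < (H ((1 : ℝ) : ℂ)).re := by rw [Complex.ofReal_one, hH1]; exact hpos.1
    exact (re_pos_of_forall_ne_zero (by linarith) hcont him hne h1').le
  -- Estermann's lemma with `R = 1 + r`, `β = 1 - δ`
  have hβ : 1 - (1 + r - 1) / 2 ≤ 1 - δ := by linarith
  have hβ1 : 1 - δ < 1 := by linarith
  have hE := hEst hU hsub hHd hM1 hHM ha0 ha1 hsum hL hβ hβ1 hHβ
  rw [show (1 : ℝ) - (1 - δ) = δ by ring, hH1] at hE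
  simpa only [hMdef, hL1] using hE

/-! ### The effective lower bound `(f, f) ≫ N / log N` -/

/-- **`(f, f) ≫ N/log N` unless `L_f` has a real zero within `1/(A log(N+2))` of `1`.** There is an
absolute `A₀ > 0` such that for every `A ≥ A₀` there is `c = c(A) > 0` with: for every `N ≥ 1` and
every `f ∈ S₂(Γ₀(N))` with `a₁(f) = 1` such that `L_f(σ) = symmSqL N f σ ≠ 0` for
`1 − 1/(A log(N+2)) ≤ σ < 1`, one has `c N/log(N+2) ≤ Re (f, f)_{Γ₀(N)}`.
Proof: Estermann's inequality (`exists_symmSqL_estermann_ineq`) with `δ = 1/(A log(N+2)) ≤ r/2`;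
if `Re L_f(1) ≥ 1` the claim is trivial (`(f,f) = [SL₂(ℤ):Γ₀(N)] L_f(1)/(8π³) ≥ N/(8π³)`); otherwise
`M = M₀N¹⁵` and `A_E δ log M ≤ 1` for `A ≥ A₀`, so `L_f(1) ≥ c_E δ/e` and
`(f,f) ≥ N L_f(1)/(8π³)` (`symmSqL_one`, `[SL₂(ℤ):Γ₀(N)] ≥ N`). The larger `A`, the narrower the
interval, i.e. the weaker the hypothesis — the shape of a published zero-free region
"`β < 1 − c/log N`", `c = 1/A`. [cite: HoffsteinLockhart1994, p. 161 ("1/log N ≪ L(1, Sym² f) provided there is no Siegel zero") and Appendix] [cite: MontgomeryVaughan2007, §11.2 Lemma 11.13] -/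
theorem petersson_lower_bound_log_of_symmSqL_zeroFree :
    ∃ A₀ : ℝ, 0 < A₀ ∧ ∀ A : ℝ, A₀ ≤ A → ∃ c : ℝ, 0 < c ∧
      ∀ (N : ℕ) [NeZero N] (f : CuspForm (Gamma0 N) 2), cuspCoeff f 1 = 1 →
        (∀ σ : ℝ, 1 - 1 / (A * Real.log (N + 2)) ≤ σ → σ < 1 → symmSqL N f σ ≠ 0) →
        c * N / Real.log (N + 2) ≤ (peterssonProduct (Gamma0 N) 2 f f).re := by
  obtain ⟨r, hr0, _, _, cE, AE, M₀, hcE, hAE, hM₀, hineq⟩ := exists_symmSqL_estermann_ineq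
  have hπ := Real.pi_pos
  have hlog2 : (1 : ℝ) / 2 < Real.log 2 := by
    have := Real.log_two_gt_d9; linarith
  have hlog20 : (0 : ℝ) < Real.log 2 := by linarith
  have hlogM₀ : 0 ≤ Real.log M₀ := Real.log_nonneg hM₀
  -- `A₀`: `δ ≤ r/2` and `A_E δ log(M₀ N¹⁵) ≤ 1`
  set A₀ : ℝ := 2 / (r * Real.log 2) + AE * (Real.log M₀ / Real.log 2 + 15) + 1 with hA₀def
  have hA₀ : 0 < A₀ := by positivity
  refine ⟨A₀, hA₀, fun A hA ↦ ?_⟩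
  have hApos : 0 < A := lt_of_lt_of_le hA₀ hA
  set c : ℝ := min (Real.log 2 / (8 * π ^ 3)) (cE * Real.exp (-1) / (8 * π ^ 3 * A)) with hcdef
  have hc0 : 0 < c := by positivity
  refine ⟨c, hc0, ?_⟩
  intro N _ f h1 hZ
  have hN0' : N ≠ 0 := NeZero.ne N
  have hN0 : (0 : ℝ) < N := Nat.cast_pos.mpr (NeZero.pos N)
  have hN1 : (1 : ℝ) ≤ N := by exact_mod_cast NeZero.one_le
  have hlogN : Real.log 2 ≤ Real.log (N + 2) := Real.log_le_log (by norm_num) (by linarith)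
  have hlogN0 : 0 < Real.log (N + 2) := by linarith
  have hlogN' : Real.log N ≤ Real.log (N + 2) := Real.log_le_log hN0 (by linarith)
  have hlogNn : 0 ≤ Real.log N := Real.log_nonneg hN1
  set δ : ℝ := 1 / (A * Real.log (N + 2)) with hδdef
  have hδ : 0 < δ := by positivity
  have hAlog : 0 < A * Real.log (N + 2) := by positivity
  -- `δ ≤ r/2`
  have hA1 : 2 / (r * Real.log 2) ≤ A := by
    have : 2 / (r * Real.log 2) ≤ A₀ := by
      rw [hA₀def]
      have : 0 ≤ AE * (Real.log M₀ / Real.log 2 + 15) := by positivity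
      linarith
    exact this.trans hA
  have hδr : δ ≤ r / 2 := by
    rw [hδdef, div_le_div_iff₀ hAlog (by norm_num : (0 : ℝ) < 2), one_mul]
    calc r * (A * Real.log (N + 2)) ≥ r * (2 / (r * Real.log 2) * Real.log 2) := by
          gcongr
      _ = 2 := by field_simp
  -- `A_E δ log (M₀ N¹⁵) ≤ 1`
  have hA2 : AE * (Real.log M₀ / Real.log 2 + 15) ≤ A := by
    have : AE * (Real.log M₀ / Real.log 2 + 15) ≤ A₀ := by
      rw [hA₀def]
      have : 0 ≤ 2 / (r * Real.log 2) := by positivity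
      linarith
    exact this.trans hA
  have hδlog : AE * δ * Real.log (M₀ * (N : ℝ) ^ 15) ≤ 1 := by
    rw [Real.log_mul (by positivity) (by positivity), Real.log_pow]
    have hbd : Real.log M₀ + (15 : ℕ) * Real.log N ≤ (Real.log M₀ / Real.log 2 + 15) * Real.log (N + 2) := by
      rw [add_mul]
      gcongr ?_ + ?_
      · rw [div_mul_eq_mul_div, le_div_iff₀ hlog20]
        exact mul_le_mul_of_nonneg_left hlogN hlogM₀
      · push_cast; gcongr
    calc AE * δ * (Real.log M₀ + (15 : ℕ) * Real.log N)
        ≤ AE * δ * ((Real.log M₀ / Real.log 2 + 15) * Real.log (N + 2)) := by gcongr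
      _ = AE * (Real.log M₀ / Real.log 2 + 15) / A := by
          rw [hδdef]; field_simp
      _ ≤ 1 := by rw [div_le_one hApos]; exact hA2
  -- Estermann
  have hE := hineq N f h1 δ hδ hδr hZ
  -- `(f, f)` versus `L_f(1)`
  set V : ℝ := (peterssonProduct (Gamma0 N) 2 f f).re with hV
  set L1 : ℝ := (symmSqL N f 1).re with hL1
  have hidx0 : (0 : ℝ) < gamma0Index N := by exact_mod_cast gamma0Index_pos N
  have hidx : (N : ℝ) ≤ gamma0Index N := by exact_mod_cast le_gamma0Index hN0'
  have hL1eq : L1 = 8 * π ^ 3 * V / gamma0Index N := by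
    rw [hL1, symmSqL_one, Complex.ofReal_re]
  have hVge : (N : ℝ) * L1 / (8 * π ^ 3) ≤ V := by
    rw [hL1eq, div_le_iff₀ (by positivity)]
    have hV0 : 0 ≤ V := re_peterssonProduct_self_nonneg f
    calc (N : ℝ) * (8 * π ^ 3 * V / gamma0Index N) = (N : ℝ) / gamma0Index N * (V * (8 * π ^ 3)) := by
          field_simp
      _ ≤ 1 * (V * (8 * π ^ 3)) := by
          gcongr
          rwa [div_le_one hidx0]
      _ = V * (8 * π ^ 3) := one_mul _
  have hc1 : c ≤ Real.log 2 / (8 * π ^ 3) := min_le_left _ _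
  have hc2 : c ≤ cE * Real.exp (-1) / (8 * π ^ 3 * A) := min_le_right _ _
  by_cases hbig : 1 ≤ L1
  · -- trivial case `L_f(1) ≥ 1`
    calc c * N / Real.log (N + 2) ≤ Real.log 2 / (8 * π ^ 3) * N / Real.log 2 := by
          gcongr
      _ = (N : ℝ) * 1 / (8 * π ^ 3) := by field_simp
      _ ≤ (N : ℝ) * L1 / (8 * π ^ 3) := by gcongr
      _ ≤ V := hVge
  · push Not at hbig
    rw [max_eq_left hbig.le, mul_one] at hE
    -- `M^{-A_E δ} ≥ e^{-1}`
    have hMpos : 0 < M₀ * (N : ℝ) ^ 15 := by positivity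
    have hexp : Real.exp (-1) ≤ (M₀ * (N : ℝ) ^ 15) ^ (-(AE * δ)) := by
      rw [Real.rpow_def_of_pos hMpos, Real.exp_le_exp]
      have : Real.log (M₀ * (N : ℝ) ^ 15) * (AE * δ) ≤ 1 := by
        rw [mul_comm]; exact hδlog
      linarith
    have hkey : cE * δ * Real.exp (-1) ≤ L1 := by
      calc cE * δ * Real.exp (-1) ≤ cE * δ * (M₀ * (N : ℝ) ^ 15) ^ (-(AE * δ)) := by gcongr
        _ ≤ L1 := hE
    calc c * N / Real.log (N + 2) ≤ cE * Real.exp (-1) / (8 * π ^ 3 * A) * N / Real.log (N + 2) := by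
          gcongr
      _ = (N : ℝ) * (cE * δ * Real.exp (-1)) / (8 * π ^ 3) := by
          rw [hδdef]; field_simp
      _ ≤ (N : ℝ) * L1 / (8 * π ^ 3) := by gcongr
      _ ≤ V := hVge

/-- **The same for newforms** (`IsNewform0 f`: normalised, so `a₁(f) = 1`).
[cite: HoffsteinLockhart1994, p. 161 and Appendix] -/
theorem IsNewform0.petersson_lower_bound_log_of_symmSqL_zeroFree :
    ∃ A₀ : ℝ, 0 < A₀ ∧ ∀ A : ℝ, A₀ ≤ A → ∃ c : ℝ, 0 < c ∧
      ∀ (N : ℕ) [NeZero N] (f : CuspForm (Gamma0 N) 2), IsNewform0 f →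
        (∀ σ : ℝ, 1 - 1 / (A * Real.log (N + 2)) ≤ σ → σ < 1 → symmSqL N f σ ≠ 0) →
        c * N / Real.log (N + 2) ≤ (peterssonProduct (Gamma0 N) 2 f f).re := by
  obtain ⟨A₀, hA₀, h⟩ :=
    _root_.Literature.NumberTheory.EllipticCurves.ModularForms.petersson_lower_bound_log_of_symmSqL_zeroFree
  refine ⟨A₀, hA₀, fun A hA ↦ ?_⟩
  obtain ⟨c, hc, hcN⟩ := h A hA
  exact ⟨c, hc, fun N _ f hf hZ ↦ hcN N f hf.2.2 hZ⟩

/-! ### The named fact from a zero-free interval of de la Vallée-Poussin shape -/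

/-- **`murty_petersson_newform_lower_bound` holds if the functions `L_f` of the newforms of elliptic
curves over `ℚ` have no exceptional real zero**: if there is a constant `A > 0` such that for every
`N`, every elliptic `E/ℚ` and every `f ∈ S₂(Γ₀(N))` with `IsNewformOf E f`, `L_f(σ) = symmSqL N f σ ≠ 0`
for `1 − 1/(A log(N+2)) ≤ σ < 1` — for `f` not of CM type this is the theorem of
Goldfeld–Hoffstein–Lieman (appendix to [HoffsteinLockhart1994]) on the real zeros of `L(s, Sym² f)`,
and for the CM forms it is the classical zero-free region of the Hecke `L`-functions `L(s, ψ²)` of the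
CM field; neither is formalised — then `Re (f,f) ≥ c N/log(N+2) ≥ (cε/3^ε) N^{1−ε}` for every `ε > 0`
(`petersson_lower_bound_log_of_symmSqL_zeroFree`, `log(N+2) ≤ (3N)^ε/ε`). A CONDITIONAL discharge of
the named fact; the unconditional theorem ([HoffsteinLockhart1994] Thm. 0.1) also covers a possible
exceptional zero by Siegel's argument (`NewformPeterssonSizePairReductionProofs`).
[cite: HoffsteinLockhart1994, Thm. 0.1 and Appendix (Goldfeld–Hoffstein–Lieman)] [cite: MurtyCongruencePrimes1999, §2] -/
theorem murty_petersson_newform_lower_bound_of_symmSqL_noExceptionalZero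
    (h : ∃ A : ℝ, 0 < A ∧ ∀ (N : ℕ) [NeZero N] (W : WeierstrassCurve ℚ) [W.IsElliptic]
      (f : CuspForm (Gamma0 N) 2), IsNewformOf W f →
        ∀ σ : ℝ, 1 - 1 / (A * Real.log (N + 2)) ≤ σ → σ < 1 → symmSqL N f σ ≠ 0) :
    murty_petersson_newform_lower_bound := by
  intro ε hε
  obtain ⟨A, hA, hZ⟩ := h
  obtain ⟨A₀, hA₀, h1⟩ := petersson_lower_bound_log_of_symmSqL_zeroFree
  obtain ⟨c, hc, hcN⟩ := h1 (max A A₀) (le_max_right _ _)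
  have h3ε : (0 : ℝ) < (3 : ℝ) ^ ε := Real.rpow_pos_of_pos (by norm_num) _
  refine ⟨c * ε / (3 : ℝ) ^ ε, by positivity, fun N _ W _ f hf ↦ ?_⟩
  have hN0 : (0 : ℝ) < N := Nat.cast_pos.mpr (NeZero.pos N)
  have hN1 : (1 : ℝ) ≤ N := by exact_mod_cast NeZero.one_le
  have hAmax : 0 < max A A₀ := lt_of_lt_of_le hA (le_max_left _ _)
  have hlogN0 : 0 < Real.log (N + 2) := Real.log_pos (by linarith)
  -- the zero-free hypothesis on the (narrower) interval for `max A A₀`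
  have hZ' : ∀ σ : ℝ, 1 - 1 / (max A A₀ * Real.log (N + 2)) ≤ σ → σ < 1 → symmSqL N f σ ≠ 0 := by
    intro σ h1σ h2σ
    refine hZ N W f hf σ (le_trans ?_ h1σ) h2σ
    have : 1 / (max A A₀ * Real.log (N + 2)) ≤ 1 / (A * Real.log (N + 2)) := by
      apply one_div_le_one_div_of_le (by positivity)
      exact mul_le_mul_of_nonneg_right (le_max_left _ _) hlogN0.le
    linarith
  have hmain := hcN N f hf.1.2.2 hZ'
  -- `log(N+2) ≤ (3N)^ε/ε`
  have hlog : Real.log (N + 2) ≤ (3 : ℝ) ^ ε * (N : ℝ) ^ ε / ε := by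
    have h1 : Real.log ((N : ℝ) + 2) ≤ ((N : ℝ) + 2) ^ ε / ε := Real.log_le_rpow_div (by positivity) hε
    have h2 : ((N : ℝ) + 2) ^ ε ≤ (3 * (N : ℝ)) ^ ε :=
      Real.rpow_le_rpow (by linarith) (by linarith) hε.le
    rw [Real.mul_rpow (by norm_num) hN0.le] at h2
    calc Real.log ((N : ℝ) + 2) ≤ ((N : ℝ) + 2) ^ ε / ε := h1
      _ ≤ (3 : ℝ) ^ ε * (N : ℝ) ^ ε / ε := by gcongr
  calc c * ε / (3 : ℝ) ^ ε * (N : ℝ) ^ (1 - ε)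
      = c * N / ((3 : ℝ) ^ ε * (N : ℝ) ^ ε / ε) := by
        rw [Real.rpow_sub hN0, Real.rpow_one]
        field_simp
    _ ≤ c * N / Real.log (N + 2) := by
        apply div_le_div_of_nonneg_left (by positivity) hlogN0 hlog
    _ ≤ (peterssonProduct (Gamma0 N) 2 f f).re := hmain

/-- **The named fact from ONE uniform zero-free interval**: if there is `δ₀ > 0` such that
`L_f(σ) ≠ 0` for `1 − δ₀ ≤ σ < 1` for the newform `f` of every elliptic curve over `ℚ` (all levels),
then `murty_petersson_newform_lower_bound` (take `A = 1/(δ₀ log 2)`: `1/(A log(N+2)) ≤ δ₀`).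
[cite: HoffsteinLockhart1994, Thm. 0.1 and Appendix] -/
theorem murty_petersson_newform_lower_bound_of_symmSqL_zeroFree
    (h : ∃ δ₀ : ℝ, 0 < δ₀ ∧ ∀ (N : ℕ) [NeZero N] (W : WeierstrassCurve ℚ) [W.IsElliptic]
      (f : CuspForm (Gamma0 N) 2), IsNewformOf W f →
        ∀ σ : ℝ, 1 - δ₀ ≤ σ → σ < 1 → symmSqL N f σ ≠ 0) :
    murty_petersson_newform_lower_bound := by
  obtain ⟨δ₀, hδ₀, hZ⟩ := h
  have hlog2 : (0 : ℝ) < Real.log 2 := Real.log_pos (by norm_num)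
  refine murty_petersson_newform_lower_bound_of_symmSqL_noExceptionalZero
    ⟨1 / (δ₀ * Real.log 2), by positivity, fun N _ W _ f hf σ h1σ h2σ ↦ hZ N W f hf σ ?_ h2σ⟩
  have hN0 : (0 : ℝ) ≤ N := Nat.cast_nonneg N
  have hlogN : Real.log 2 ≤ Real.log (N + 2) := Real.log_le_log (by norm_num) (by linarith)
  have hlogN0 : 0 < Real.log (N + 2) := by linarith
  have : 1 / (1 / (δ₀ * Real.log 2) * Real.log (N + 2)) ≤ δ₀ := by
    rw [one_div_mul_eq_div, one_div_div, div_le_iff₀ hlogN0]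
    exact mul_le_mul_of_nonneg_left hlogN hδ₀.le
  linarith

/-! ### Real zeros near `1` are invariants of the twist class -/

section Twist

variable {N₁ N₂ : ℕ} [NeZero N₁] [NeZero N₂] {f₁ : CuspForm (Gamma0 N₁) 2} {f₂ : CuspForm (Gamma0 N₂) 2}

/-- **Twist-equivalent newforms have the same real zeros of `L_f` on the Siegel ball.** For the
newforms `f₁, f₂` of two elliptic curves with `|a_p(f₁)| = |a_p(f₂)|` at all primes `p ∤ N₁N₂`, and a
real `σ > 0` in the ball `|s − 2| < 1 + 2r` (`Re > 0`, `ζ₁ ≠ 0` there): `L_{f₁}(σ) = 0 ↔ L_{f₂}(σ) = 0`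
(`symmSqL_mul_prod_sqLocalFactor_eq` at `σ`, where every `E_p(f, σ) ≥ 1` is a non-zero real).
[cite: HoffsteinLockhart1994, Thm. 0.1 (proof, the twist-equivalent case)] -/
theorem symmSqL_ofReal_eq_zero_iff_of_twistEquiv {W₁ W₂ : WeierstrassCurve ℚ} [W₁.IsElliptic]
    [W₂.IsElliptic] (hf₁ : IsNewformOf W₁ f₁) (hf₂ : IsNewformOf W₂ f₂)
    (h : ∀ p : ℕ, p.Prime → ¬ p ∣ N₁ * N₂ → ‖cuspCoeff f₁ p‖ = ‖cuspCoeff f₂ p‖)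
    {r : ℝ} (hr0 : 0 ≤ r) (hr : ∀ s ∈ ball (2 : ℂ) (1 + 2 * r), 0 < s.re ∧ riemannZeta₁ s ≠ 0)
    {σ : ℝ} (hσ0 : 0 < σ) (hσ : (σ : ℂ) ∈ ball (2 : ℂ) (1 + 2 * r)) :
    symmSqL N₁ f₁ σ = 0 ↔ symmSqL N₂ f₂ σ = 0 := by
  have hEq := symmSqL_mul_prod_sqLocalFactor_eq hf₁ hf₂ h hr0 hr hσ
  simp only [] at hEq
  have hprime : ∀ p ∈ (N₁ * N₂).primeFactors, p.Prime := fun p hp ↦ Nat.prime_of_mem_primeFactors hp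
  have hE : ∀ {M : ℕ} [NeZero M] {W : WeierstrassCurve ℚ} [W.IsElliptic] {g : CuspForm (Gamma0 M) 2},
      IsNewformOf W g → ∏ p ∈ (N₁ * N₂).primeFactors, sqLocalFactor g p σ ≠ 0 := by
    intro M _ W _ g hg
    refine Finset.prod_ne_zero_iff.mpr fun p hp ↦ ?_
    obtain ⟨hval, hge⟩ := hg.sqLocalFactor_ofReal (hprime p hp) hσ0
    rw [hval]
    exact_mod_cast (lt_of_lt_of_le one_pos hge).ne'
  constructor
  · intro h0
    have : symmSqL N₂ f₂ σ * ∏ p ∈ (N₁ * N₂).primeFactors, sqLocalFactor f₁ p σ = 0 := by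
      rw [← hEq, h0, zero_mul]
    exact (mul_eq_zero.mp this).resolve_right (hE hf₁)
  · intro h0
    have : symmSqL N₁ f₁ σ * ∏ p ∈ (N₁ * N₂).primeFactors, sqLocalFactor f₂ p σ = 0 := by
      rw [hEq, h0, zero_mul]
    exact (mul_eq_zero.mp this).resolve_right (hE hf₂)

/-- **The zero-free hypothesis is a property of the twist class**: there is `η₀ > 0` (twice the Siegel
radius) such that for every `0 < η ≤ η₀` and all twist-equivalent elliptic newforms `i, j`
(`TwistEquiv i j`: `|a_p(f_i)| = |a_p(f_j)|` for `p ∤ N_iN_j`), `L_{f_i}` is zero-free on `[1 − η, 1)` iff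
`L_{f_j}` is. So the hypothesis of `murty_petersson_newform_lower_bound_of_symmSqL_zeroFree` needs to be
verified on one newform per quadratic-twist class.
[cite: HoffsteinLockhart1994, Thm. 0.1 (proof, the twist-equivalent case)] -/
theorem twistEquiv_zeroFree_iff :
    ∃ η₀ : ℝ, 0 < η₀ ∧ ∀ η : ℝ, 0 < η → η ≤ η₀ → ∀ i j : EllipticNewformIndex, TwistEquiv i j →
      ((∀ σ : ℝ, 1 - η ≤ σ → σ < 1 → symmSqL i.N i.f σ ≠ 0) ↔
        (∀ σ : ℝ, 1 - η ≤ σ → σ < 1 → symmSqL j.N j.f σ ≠ 0)) := by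
  obtain ⟨r, hr0, hr4, hr⟩ := exists_siegel_radius
  refine ⟨r, hr0, fun η hη hηr i j hij ↦ ?_⟩
  have hmem : ∀ σ : ℝ, 1 - η ≤ σ → σ < 1 → 0 < σ ∧ (σ : ℂ) ∈ ball (2 : ℂ) (1 + 2 * r) := fun σ h1 h2 ↦
    ⟨by linarith, ofReal_mem_siegel_ball (by linarith) (by linarith)⟩
  constructor
  · intro hZ σ h1 h2 h0
    obtain ⟨hσ0, hσ⟩ := hmem σ h1 h2
    exact hZ σ h1 h2 ((symmSqL_ofReal_eq_zero_iff_of_twistEquiv i.isNewformOf j.isNewformOf hij hr0.le hr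
      hσ0 hσ).mpr h0)
  · intro hZ σ h1 h2 h0
    obtain ⟨hσ0, hσ⟩ := hmem σ h1 h2
    exact hZ σ h1 h2 ((symmSqL_ofReal_eq_zero_iff_of_twistEquiv i.isNewformOf j.isNewformOf hij hr0.le hr
      hσ0 hσ).mp h0)

end Twist

end Literature.NumberTheory.EllipticCurves.ModularForms

end
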